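import Mathlib
import HarnessLib
import HarnessLib.Audit
import Summits.AtomisticToContinuum.Statement
import Literature.Analysis.UnboundedOperators.LinearizedBoltzmann
import Literature.Barriers.AtomisticToContinuum.MazurBoundBallistic
import Literature.Analysis.FluidPDE.LocalForecastCorrector
import Summits.AtomisticToContinuum.HydrodynamicLimit.Theorems.TwoClocksEntropyToHydro
import HarnessLib.Audit.Status.Attr

/-!
Route: AntiMazurCoboundaries

CLOSED (superseded) 2026-08-17T15:41:47Z by planner-rbadge-AtomisticToContinuum-AntiMazurC-64c9a614-g2-0 — reason: superseded:route-AtomisticToContinuum-FluxGibbsianityLdDrude — superseded by route-AtomisticToContinuum-FluxGibbsianityLdDrude — note: route-repair rbadge-g2 (needs_repair = tribunal-failed:summit-strength on KineticWindowGronwall 9282, round 0). CLOSE superseded by FluxGibbsianityLdDrude. (1) The deciding cone of `closes` {CorrectorPressureDecay X=14135, PressureCertificateTransfer 14139 PROVED, KineticWindowGronwall 9282} is item. The file is kept as the record of this route; refuted decls are indexed as negative knowledge (`ledger negatives`).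

# Route AntiMazurCoboundaries — local anti-Mazur coboundary certificates bound the LD-Drude
functional from above and commute with the thermodynamic limit; Yau's ergodic input becomes an
N-free finite-cluster pressure bound, one quantifier swap above a theorem-grade Green–Kubo rung

Realises card anti-mazur-coboundary-certificates (spine); D-0027 §2.1-conforming re-opening of the
retired
route-AtomisticToContinuum-AntiMazurCertificates; promote-to-A revisions 2026-08-15 (gen 0: typed
layer 2 under X, N-free core,
misstated informal items retired; gen 2: kinetic-validity ladder — typed dilute-corner rung
BoltzmannGreenKubo, corrected proof
plan of the quantitative rung, honest role of the certificates; route-repair 2026-08-16: the two L²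
rungs BoltzmannGreenKubo
(stmt-13985) and ShearStressHalfDrude (stmt-14136) leave the item list — milestones outside the LD
deciding cone, recorded below and in
the rationale, evidence DISPOSITION.md on both items; second route-repair 2026-08-16, rev 12:
CRUX-ONLY deciding theorem — the
unproved shared assembly item Assembly (stmt-9240) is no longer a hypothesis of `closes`, the
entropy step being the landed theorem
Theorems.hydrodynamicLimit_of_relEntropyVanishing, imported; third route-repair 2026-08-16, rev 13:
after the statement re-type
p126922 — `_root_.HydrodynamicLimit` is now the PACKING-GUARDED d = 3 Euler limit, a weaker `def` —
`closes` post-composes that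
theorem with the Statement's bridge `HydrodynamicLimit.of_unguarded`: same three binders, no guard
hypothesis, no new item). IT SUFFICES TO SHOW
X = CorrectorPressureDecay (EXPONENTIAL ANTI-MAZUR): under the flow-invariant global Gibbs law G_N
of N+1 deterministic
hard spheres on 𝕋³ at fixed small reduced density, for every bounded fast one-body observable F =
Σ_i φ(x_i) g((v_i−u₀)/√θ)
(g ⊥ 1, v, |v|² under the Maxwellian, |φ| ≤ 1, |g| ≤ κ) and every δ > 0 there are a kinetic scale τ₀
and, for all large N
and every flow Φ, a lag and a bounded measurable CORRECTOR W with static defect pressure ∫exp(2(F −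
lag⁻¹(W∘Φ_lag − W))) dG_N
≤ e^(δ(N+1)) and cost ∫exp(4|W|/h₀) dG_N ≤ e^(δ(N+1)), h₀ = τ₀(N+1)^(-1/3).
Coboundaries certify the ABSENCE of (LD-)ballistic transport from above, dual to Mazur's charges
certifying it from below;
by the one-line ExponentialCertificate (Jensen in time + invariance + Cauchy–Schwarz, provable now)
X ⟹ KineticFluxLdDecay
(shared stmt-10967) ⟹ RelEntropyVanishing (shared target 0766, via the shared kinetic-window
Gronwall 9282) ⟹
HydrodynamicLimit (by-name entropy step; since rev 12 invoked inside `closes` as the LANDED theorem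
Theorems.hydrodynamicLimit_of_relEntropyVanishing, which concludes the unguarded Literature
conjecture, followed since rev 13 by
`HydrodynamicLimit.of_unguarded` onto the packing-guarded Statement — the shared item 9240
`Assembly` states the same step and stays
listed, but is no longer a hypothesis). X is refuter-certified EQUIVALENT in strength to 10967
(conceded; D-0031 axis 1 is answered in the rationale): what the corrector form buys is LOCALITY —
the certificate entries of a
LOCAL corrector are equal-time Gibbs integrals of sums of local bounded terms, so uniformity in N is
discharged by equilibrium
statistical mechanics plus finite speed of influence (InfluenceLocality, typed crux), and X reduces
(LocalCertificateTransfer,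
typed support) to the N-FREE core CellForecastPressureDecay (typed crux): an exponential-moment
bound for window-T local
forecasts of ONE finite canonical Gibbs cluster, horizon fixed before the cluster grows. After
localisation that cluster is a
Boltzmann–Grad gas on a BOUNDED domain with effective parameter ε_eff = diameter/mean free path =
√2πσ³ — literally the
setting of Bodineau–Gallagher–Saint-Raymond–Simonella — which is why, one quantifier swap (σ₀ chosen
AFTER the tolerance
instead of before) below the core, there sits a theorem-grade RECORDED RUNG, BoltzmannGreenKubo
(typed 2026-08-15 as stmt-13985,
grounded NEW, crux-attack survived, three checked skeleton lines and a picked line on its record; an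
L² statement, hence since
2026-08-16 a milestone outside this LD cone rather than an item — rationale, RANKED CRUXES):
uniformly in N, the kinetic-window
variance of F times the window length converges in the dilute corner to twice the Boltzmann
Green–Kubo value
2∫φ²·⟨g,(−L)⁻¹g⟩_M, L the in-tree linearised hard-sphere operator whose spectral gap is PROVED in
the tree. The open content of X
is thereby isolated in its sharpest known form: an infinite kinetic validity horizon at fixed
positive density (plus, for the LD
currency, exponential-moment rather than covariance control).
Lean: `CorrectorPressureDecay`

## Assembly
DECIDING THEOREM (glue.lean; crux-only form installed by the second 2026-08-16 route-repair, rev 12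
— human ruling 2026-08-16: a
hypothesis of `closes` must be a CRUX item or an item already PROVED — its term re-elaborated by the
third route-repair, rev 13, after
the statement re-type p126922; gate verdict native OK, axioms propext / Classical.choice /
Quot.sound):
`theorem closes (h₁ : CorrectorPressureDecay) (h₂ : PressureCertificateTransfer) (h₃ :
KineticWindowGronwall) : _root_.HydrodynamicLimit := _root_.HydrodynamicLimit.of_unguarded
(Summit.AtomisticToContinuum.HydrodynamicLimit.Theorems.hydrodynamicLimit_of_relEntropyVanishing (h₃
(h₂ h₁)))`
— hypotheses: the crux X (14135); the PROVED transfer (14139,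
`Theorems.pressureCertificateTransfer_proof`, admissible as a proved
item — its Theorems module imports this file, so it cannot be invoked inside the term before the
gate's `Closes.lean` move) turning
X into KineticFluxLdDecay (shared crux 10967); and the shared kinetic-window Gronwall crux (9282)
turning that into RelEntropyVanishing
(shared target 0766). The by-name entropy step RelEntropyVanishing → `_root_.HydrodynamicLimit` is
no longer ASSUMED: it is the
LANDED theorem
`Summit.AtomisticToContinuum.HydrodynamicLimit.Theorems.hydrodynamicLimit_of_relEntropyVanishing`
(Theorems/TwoClocksEntropyToHydro.lean, p85039 accepted 2026-08-16, standard axioms: entropy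
inequality for events from the tree's
Fenchel–Young bound, then `Measure.le_map_apply` along `HardSphereFlow.measurable_flow`), whose
hypothesis is the shared target 0766
VERBATIM, so it consumes this route's `RelEntropyVanishing` definitionally, and whose conclusion is
the UNGUARDED Literature conjecture
`Literature.MathematicalPhysics.KineticTheory.HydrodynamicLimit` — equal by `abbrev` to the
Statement decl until the re-type p126922
(2026-08-16T21:32Z) made `_root_.HydrodynamicLimit` the PACKING-GUARDED limit (`∃ η₀ > 0` outermost;
only solutions with
ρ_t(x)σ³ < η₀ on [0,T) × 𝕋³), a weaker `def` (old ⇒ new); the Statement's own bridge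
`_root_.HydrodynamicLimit.of_unguarded` (take any η₀,
ignore the guard) finishes, so the new conjunct is supplied from the inputs already assumed and no
packing-guard hypothesis or item
enters (this route's cruxes are equilibrium statements at constant profiles; the guard would matter
only if the shared target 0766 /
Gronwall 9282 were ever re-typed in-band, KILL CRITERIA); this file imports that module (its only
Summits-side
import is Theses.TwoClocks — no cycle; re-point the import if a route-free home of the theorem
lands, which would also spare this
file's ~45 importers a rebuild on every TwoClocks rewrite). The shared item `Assembly` (stmt-9240,
RelEntropyVanishing →
_root_.HydrodynamicLimit; not a hypothesis) STAYS LISTED as the route's by-name assembly statement —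
the ledger closed it
2026-08-16T12:16Z as proved by that theorem (a match against the old `abbrev`); against the re-typed
Statement it is the one-liner
`fun h => HydrodynamicLimit.of_unguarded (hydrodynamicLimit_of_relEntropyVanishing h)` (sorry-free,
GlueTest.lean `assembly_test`, rc 0). The alternative chain through the route's OWN
normal form also elaborates (GlueTest.lean rc 0): `closes_via_core (h₁ : InfluenceLocality) (h₂ :
CellForecastPressureDecay)
(h₃ : LocalCertificateTransfer) (h₄ : PressureCertificateTransfer) (h₅ : KineticWindowGronwall) :
_root_.HydrodynamicLimit := HydrodynamicLimit.of_unguarded (hydrodynamicLimit_of_relEntropyVanishing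
(h₅ (h₄ (h₃ h₁ h₂))))`
— not installed as `closes`: LocalCertificateTransfer (13917) is an OPEN support (it would first
have to be re-badged crux, or the
layer registered as a split of X), and the vetted chain X → 10967 → 0766 → Statement stays stable.
No longer items (route-repair 2026-08-16, gate check glue.unused-crux): the quantitative rung
ShearStressHalfDrude (stmt-14136) and the
dilute-corner rung BoltzmannGreenKubo (stmt-13985) — second-moment statements, logically
incomparable uniformly in N with every member
of this exponential-moment cone (neither direction of 'pressure o(N) at fixed amplitude' vs
'variance o(N)' holds), so no honest glue
`rung → hypothesis` exists and they are milestones / park signals of the line, not cruxes of the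
decision; statements, stamps, MD results,
landed Negative theorems and Cruxes/ workfiles persist on the (moot) items. Not hypotheses of
`closes` but used in proofs of its cone:
the certificate layer ExponentialCertificate, VarianceCertificate, AntiMazurIdentity,
HomogeneousInvariance (all four PROVED by 2026-08-16, as is
PressureCertificateTransfer); KineticFluxLdDecay (shared crux, the
consequent of X, staffed through FluxGibbsianityLdDrude); and the typed LAYER 2 under X —
InfluenceLocality, CellForecastPressureDecay, LocalCertificateTransfer
(`corrector_of h₁ h₂ h₃ : CorrectorPressureDecay := h₃ h₁ h₂`).

Rationale: WHY THIS LINE. Mechanism: certificate by dual witness, made LOCAL, with the dynamical input confined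
to a FINITE kinetic horizon. Mazur/Suzuki (tree:
Literature.Barriers.AtomisticToContinuum.Mazur1969_inequality, proved) bound Drude weights from
BELOW by charges; the other half of von Neumann's splitting, (Ker L)^⊥ = cl Ran L, bounds them from
ABOVE by coboundaries (AntiMazurIdentity, provable now, three sorry-free proofs attached; L² germ:
MazurBoundBallisticNarrow (4), BernardinHuveneers2013 §4 Lemma 1), and at the exponential level one
line (ExponentialCertificate: Jensen in time, EXACT under the invariant G_N, + Cauchy–Schwarz)
bounds the kinetic-window LD functional of OllaVaradhanYau1993 §3 by the single-lag defect pressure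
of F − D_W plus a cost O(|W|/h). Imported area: Varadhan's NONGRADIENT method
(Varadhan1993EntropyMethods, Quastel1992; KipnisLandim1999 Ch. 7 Thm 1.1 p. 147) transplanted to
DETERMINISTIC hard spheres at EULER scale, where there is no spectral gap (KipnisLandim1999 p. 185):
the Feynman–Kac/gap step becomes Jensen in time plus a static localisation. HONEST ROLE OF THE
CERTIFICATES (gen-2 audit, evidence PROMOTE-g2.md on 14135): exact bookkeeping, not the source of
decay — (i) 10967/10952 read ∃τ, so the prover CHOOSES the window, and Λ_(mS) ≤ Λ_S (Hölder +
invariance) gives monotonicity for multiples; (ii) a ONE-BODY (Chapman–Enskog) corrector W = Σφ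
w(v_i), w = L⁻¹g, certifies nothing below the window-S Drude fraction itself (single-lag floor
(1+e^(−λ·lag))/2 in the Markov idealisation); (iii) a many-body FORECAST corrector of horizon S has
defect = r(S) + within-lag shot noise. So ANY certificate proof of a Drude fraction ≤ θ needs
control of equilibrium two-time (L²) or cumulant (LD) functionals of one-body empirical fields up to
S ≍ 2/(λθ) kinetic units — over a FINITE horizon the best-understood object of rigorous kinetic
theory: short times VanbeijerenEtAl1980 (= BodineauEtAl2024 Thm 1.1 [BLLS80, BGSS3]); ALL kinetic
times in the Boltzmann–Grad limit BGSSCPAM2023 Thm 1.1 = BodineauEtAl2024 Thm 1.2 (covariance of the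
equilibrium fluctuation field → linearised Boltzmann, test functions in L²_M, d ≥ 3, horizon
o((log|log ε|)^(1/4)); arXiv:2012.03813 p. 4, arXiv:2201.04514 pp. 4–6); LD over Lanford's time
BGSSAnnals2023. What the certificates DO buy is locality: the entries of a LOCAL corrector are
equal-time Gibbs integrals, so uniformity in N becomes equilibrium statistical mechanics
(LocalCertificateTransfer) plus finite speed of influence (InfluenceLocality).
WHY THIS FORM IS EASIER (D-0031 axis 1; X ⇔ shared 10967 is refuter-certified and conceded). Of the
three dual formulations of 'zero LD-Drude weight' on the board — KERNEL (MourreKoopmanCharges),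
STATE (FluxGibbsianityLdDrude, TwoClocks, CurrentTiltQuench), RANGE (this route) — only the range
side has finite-volume witnesses that are LOCAL FUNCTIONS, and after localisation (InfluenceLocality
+ the static transfer: DLR conditioning, 27-colour chessboard Hölder, canonical/grand-canonical
comparison at LD precision, PulvirentiTsagkarogiannis2012, Scola2021, Ruelle1969 Thm 4.2.3) the
object left is ONE isolated cluster that is a Boltzmann–Grad gas on a BOUNDED domain: in
mean-free-path units its sphere diameter is ε_eff = √2πσ³ and it holds ≍ ε_eff^(−2) spheres per
cubic mean free path — LITERALLY the setting of Bodineau–Gallagher–Saint-Raymond–Simonella, whose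
pruning + L²-duality estimates tolerate the polynomial losses in the cluster size that a
uniform-in-N statement cannot. This is a named tool that closed the comparable statement: the
recorded rung BoltzmannGreenKubo (stmt-13985; dilute corner: σ₀ chosen AFTER the observable and the
tolerance; a recorded MILESTONE outside the cone since 2026-08-16, see RANKED CRUXES) is a
corollary-grade ADAPTATION of BodineauEtAl2024 Thm 1.2 (fixed domain ⇒ domain growing with N, by
locality; grand-canonical ⇒ canonical; macroscopic modulation φ; window integral by dominated
convergence in t since |Cov(t)| ≤ Var by stationarity), and its kinetic side is IN THE TREE AND
PROVED: the linearised hard-sphere operator `hardSphereLinearizedOp`, the Chapman–Enskog Dirichlet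
form `dirichletFormInv` (= ⟨g,(−L)⁻¹g⟩_M; positivity/boundedness `_holds` PROVED) and the
Baranger–Mouhot spectral gap (`le_neg_maxwellianInner_hardSphereLinearizedOp_of_orthogonal_holds`,
BarangerMouhot2005), which gives the Green–Kubo tail |s·V_B(s) − 2⟨g,(−L)⁻¹g⟩| ≤ 2‖g‖²/(λ²s). The
gain over 10967 is therefore structural and now EXPLICIT: the same functional is a theorem in the
dilute corner and the open core is exactly ONE QUANTIFIER SWAP (σ₀ before δ: an infinite kinetic
validity horizon at fixed positive density, versus BGSS's horizon → ∞ only as ε_eff → 0;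
LutskoToth2020 §1: beyond r^(−d+1) 'some genuinely new idea' is required). MONDAY MORNING (axis 2):
(1) [DONE 2026-08-16: AntiMazurIdentity, VarianceCertificate, ExponentialCertificate,
HomogeneousInvariance and the glue PressureCertificateTransfer are PROVED in Theorems/] land the
certificate layer; (2) first stub of InfluenceLocality: the equilibrium sup-speed tail G_N{∃t ≤ Tℓ:
|v_i(t) − u₀| > u} ≤ (1 + c_σT)·C·u·e^(−u²/2θ) uniformly in N (stationarity + the equilibrium
collision-rate identity), then the deterministic packing bound and energy conservation along
influence chains; (3) [superseded 2026-08-16] milestone M1's crux chain stays on its own record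
(picked line two-level-corrector-ring-defect; honest open stub: the generator-form Stosszahl defect
over a fixed kinetic window, N → ∞ first at fixed σ); its locality lemmas ride --supports on
InfluenceLocality / LocalCertificateTransfer. What it does that other routes do not: TwoClocks
(14440/14446) and FluxGibbsianityLdDrude (10967) STATE the wall, AlphaScalingLadder climbs scalings
of the whole limit, StiffCollisionalRelaxation/ChapmanEnskogBBGKY work the moment hierarchy; only
this route has a provable-now certificate layer, a typed locality theorem, the N-free normal form of
the wall AND, on record (stmt-13985/14136, vetted, MD-checked), theorem-grade dynamical rungs for
the wall's own functional.
RANKED CRUXES. #0 RelEntropyVanishing (target, shared 0766) — Yau's relative-entropy form of the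
limit; fails iff entropy production ≥ cN before the first shock. #2 CorrectorPressureDecay (crux,
the route's X, tier-deciding) — as in the thesis; refuter-certified consistent (W = 0, transport and
telescoping correctors fail; ∃κ necessary, floor κ < 0.489) and EQUIVALENT to 10967 (discrete Fejér
corrector ⇐, ExponentialCertificate ⇒); by the audit above its decay content is 'kinetic validity
horizon = ∞ at fixed σ', reached neither by correctors nor by any printed expansion; false iff a
uniform-in-N LD-Drude weight survives (hidden extensive quasi-local charge overlapping a fast
one-body g). [KipnisLandim1999, OllaVaradhanYau1993, BGSSCPAM2023, BodineauEtAl2024, LutskoToth2020,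
Spohn1991] #4 KineticFluxLdDecay (crux, shared 10967) — the consequent of X via
PressureCertificateTransfer, re-wanted verbatim; staffed once, through FluxGibbsianityLdDrude; it
stays in the crux block because KineticWindowGronwall references its decl (a support would render
below the cruxes). #5 KineticWindowGronwall (crux, shared 9282) — 10967 → 0766 inside Yau's torus
Gronwall; needs the collisional twin and velocity tails (HighMomentumCutoff) not among its
hypotheses. #6 CellForecastPressureDecay (crux, typed; the N-FREE CORE = normal form of X after
LocalCertificateTransfer): window-T time averages of g along R-local forecasts of ONE canonical
Gibbs cluster have cell pressure ≤ e^(δL³), uniformly in n ≤ 2L³ (per volume, so n = 0, 1 and free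
particles are consistent; the σ = 0 gas fails it for n ≍ L³ — an interaction effect); after the
chessboard step the residual uniformity is over blocks of FIXED size ≍ R(T)³ with arbitrary boundary
data — a BG gas on a bounded domain — but T → ∞ at FIXED ε_eff exceeds every printed horizon: the
open quantifier swap lives exactly here. [BGSSCPAM2023, BodineauEtAl2024, BGSSAnnals2023,
LutskoToth2020, VanbeijerenEtAl1980, Spohn1991, BuragoFerlegerKononenko1998] #7 InfluenceLocality
(crux, typed; provable-grade, Monday-morning item): exponential moments of #{i : ∃t ≤ Tℓ, true state
≠ R-local forecast} have pressure o(N); fails AS AN LD STATEMENT if collision cascades keep the cost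
per corrupted forecast bounded as R → ∞ at fixed T — repair = first-moment version (all that the
recorded L² milestones consume). [Alexander1976, MarchioroPellegrinottiPresutti1975,
CagliotiMarchioroPulvirenti2000, DobrushinFritz1977, Sinai1972, Spohn1991 Thm 1.2] Supports (rank
9): ExponentialCertificate (PROVED, 14137), VarianceCertificate (PROVED, 14138; its L² clients
10952/14136 are no longer items here — the finite-lag L² certificate stays a reusable tree theorem),
AntiMazurIdentity (PROVED, 14140), HomogeneousInvariance (shared 9621, PROVED),
PressureCertificateTransfer (X → 10967, PROVED: pressureCertificateTransfer_proof, 14139),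
LocalCertificateTransfer (InfluenceLocality → CellForecastPressureDecay → X, open). Assembly (shared
9240, RelEntropyVanishing → _root_.HydrodynamicLimit; ledger-closed 2026-08-16T12:16Z against the
old abbrev): listed, but since rev 12 not a hypothesis of `closes` (crux-only ruling 2026-08-16) —
the entropy step is the landed theorem Theorems.hydrodynamicLimit_of_relEntropyVanishing (p85039)
invoked inside `closes`, post-composed since rev 13 (statement re-type p126922) with
`HydrodynamicLimit.of_unguarded`; 9240 follows the same way in one line (GlueTest.lean
`assembly_test`). RECORDED MILESTONES, NOT ITEMS (route-repair 2026-08-16, gate check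
glue.unused-crux; evidence DISPOSITION.md on both items): (M1) BoltzmannGreenKubo (stmt-13985;
grounded NEW, Disproof v11 + landed Negative modules, 3 checked lines, picked
two-level-corrector-ring-defect): in the corner N → ∞, σ → 0, s → ∞ (∀η ∃s₀ ∀s ∃σ₀ ∀σ ∃N₀ ∀N ∀Φ) the
finite-N kinetic-window Drude functional s·(N+1)⁻¹E_G(window average of F)², h = s·ℓ/(σ²√θ), IS
2(∫φ²)·dirichletFormInv L g within η, L = hardSphereLinearizedOp (PROVED gap) [BodineauEtAl2024 Thm
1.2, BGSSCPAM2023 Thm 1.1, VanbeijerenEtAl1980, BarangerMouhot2005]; (M2) ShearStressHalfDrude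
(stmt-14136; grounded NEW, Disproof rev 4, 3 lines, dilute-corner form reduced sorry-free to M1): at
fixed σ < σ₀, for the cutoff shear stress and every φ, some kinetic window leaves at most HALF of
the static variance (N+1)∫φ²∫g²dγ ballistic, uniformly in N ≥ N₀ [BGSSCPAM2023, AlderWainwright1970,
ErpenbeckWood1985]. WHY THEY ARE NOT CRUXES OF THE DECISION: the cone of `closes` is
exponential-moment-valued (rate o(N), FIXED amplitude) end to end; M1/M2 bound second moments at
scale N; uniformly in N the two currencies are incomparable in both directions (a ±N^0.9 window sum
has pressure o(N) and variance N^1.8; Var/N → 0 says nothing about cumulants of order ≥ 3 at fixed κ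
— the LD analogue of M1 is open even in the Boltzmann–Grad corner, (b) below), so a glue `rung →
cone member` needs a conjunct yielding the member alone (e.g. Green–Kubo domination of the pressure
⟹ 10967 directly, DF(g) < ∞ PROVED) — costume; the honest decomposition with M1 load-bearing ((f)
below) has its head outside this cone. They stay cited as milestones/park signals; the moot items
keep statements, stamps, stubs, MD data and Cruxes/ workfiles and re-attach to any route re-asking
the signature. Dropped earlier (gen 2): FastObservableMeanErgodic (shared 10952, alive on
FluxGibbsianityLdDrude as support).
TWO-LAYER PLAN. Layer 2 under X (typed, Sketch rc 0; definition LocalForecastCorrector landed):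
CorrectorPressureDecay ⇐ InfluenceLocality ∧ CellForecastPressureDecay via LocalCertificateTransfer,
proof plan unchanged from gen 0 (Fejér local forecast corrector of horizon Tℓ at the FIXED kinetic
lag λℓ — the refuters' repair C′; exact identity F − D_(W^true) = shot noise + window averages;
error corrector on bad particles via InfluenceLocality; Hölder in three groups; shot-noise pressure
ψ(λ)(N+1) → 0 by short-time cluster dynamics, Sinai1972 / MarchioroPellegrinottiPresutti1975; static
transfer; torus-cluster lift; cost clause τ₀ ≥ 2κT/δ; choices δ → T → λ → R → L → N₀ → τ₀, no loop).
Recorded ladder under the core (milestones, on their own records): M1 ⇐ [BGSS Thm 1.2 on a torus of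
side Λ mean free paths with Λ-uniform constants, OR first-moment InfluenceLocality E#bad/(N+1) → 0 +
the theorem on isolated Euclidean clusters] + [canonical ⇒ grand-canonical covariances for g ⊥ 1] +
[GK tail from the proved gap, or the picked line's algebraic second corrector]; M2 ⇐ the same at
FIXED small ε_eff with quantitative remainders + r_B(S) ≤ 0.45 from gap + Dirichlet form. Items of
this route: k = 2 + glue under X, depth 1; no third layer (not registered as a gate split of X — a
tenure option that would put 13915–13917 into the deciding cone).
KILL CRITERIA. ¬CellForecastPressureDecay for one admissible g at every horizon T (a positive bulk
LD-Drude weight of a dilute hard-sphere cluster family = a hidden quasi-local conserved charge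
overlapping a one-body fast observable) closes this route (close --reason
refuted:CorrectorPressureDecay) and, given LocalCertificateTransfer, refutes 10967 for
FluxGibbsianityLdDrude, 14440 for TwoClocks and OneBodyCompleteness for MourreKoopmanCharges: a
summit-level negative. ¬KineticFluxLdDecay likewise. A disproof of milestone M1 (the finite-N
Green–Kubo integral deviating from Boltzmann's in the dilute corner; standing Disproof v11 found no
kill, only load-bearing mutations) signals that BGSS's estimates are not local — the route would
then restate the wall and should be closed superseded by FluxGibbsianityLdDrude. A disproof of M2
(more than half of the shear stress ballistic at every window, uniformly in N) parks the line (a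
surviving Drude weight physically; formally neither ¬M1 nor ¬M2 refutes X, the L² and LD currencies
being incomparable uniformly in N). ¬InfluenceLocality AS STATED (LD form too strong) does NOT kill
the line: repair to the first-moment form (route DORMANT meanwhile). ¬RelEntropyVanishing closes
every Yau-family route — UNLESS the witness is an imploding / densifying classical solution leaving
the dilute band: since the re-type p126922 the Statement speaks only of solutions with ρ_t(x)σ³ <
η₀, while 0766 and 9282 keep the unguarded `∃σ₀ ∀T ∀solution` prefix, so such a refutation would
exploit exactly the over-strength the audit removed from the Statement and does not kill the line:
repair = the in-band target (0766 with the packing guard as an extra antecedent, `∃ η₀` outermost) +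
the in-band Gronwall, `closes` keeping its shape (the guarded conclusion is then reached without
`of_unguarded`). An MD PLATEAU of the window variance ratio of the cutoff shear stress, or an MD
Green–Kubo integral departing from 2⟨g,(−L)⁻¹g⟩ by more than the Enskog correction at σ ≤ 0.2
(cheapest falsifier (ii)), parks the route. RelEntropyVanishing or 10967 proved elsewhere moots
`closes`; the certificates, InfluenceLocality, the transfer and the two recorded rungs keep
independent value (first uniform-in-N dynamical theorems for a deterministic continuum fluid at
fixed or asymptotically small density).
NOT DECOMPOSED YET. (a) Inside CellForecastPressureDecay: the non-perturbative decorrelation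
mechanism at fixed σ — nothing in print reaches it (horizons: o((log|log ε|)^(1/4)) for covariances,
O(log log|log ε|) for moments, BodineauEtAl2024 Rem. 1.3; r^(−2)|log r|^(−2) for the random Lorentz
gas, LutskoToth2020); candidate levers for crux-ideators: uniform-in-time RESUMMED recollision
bounds (NoDensityExpansionNarrow certifies the damped ring integral is bounded uniformly in time
while each density order diverges), Markovian couplings à la Lutsko–Tóth for tagged spheres among
moving scatterers, L²-duality iterated on dyadic horizons. (b) The LD analogue of BoltzmannGreenKubo
(dilute corner, long kinetic windows, small amplitude κ): OPEN EVEN AS ε → 0 — long-time equilibrium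
large deviations are the unbuilt storey of the BGSS programme (BGSSAnnals2023 Thm 3 covers Lanford's
time; BodineauEtAl2024 controls moments, not exponential moments); it is the next rung and the
honest gap between the L² ladder and Yau's LD currency; untyped (item cap), its shape is 10967 with
∃σ₀ moved after (g, δ) and κ kept before δ. (c) Inside milestone M1 (its own record,
Cruxes/BoltzmannGreenKubo/PICKED.md): domain-uniformity of BGSS's pruning or the generator-form
Stosszahl defect of the two-level corrector; canonical vs grand-canonical covariances, torus-cluster
↔ Euclidean lift, drift u₀ (Galilean shift u₀h → 0). (d) Inside LocalCertificateTransfer /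
InfluenceLocality: as listed in gen 0. (e) Downstream (9282, shared): collisional twin of 10967,
velocity tails under the TRUE law, virial equation of state. (f) The honest decomposition in which
M1 IS load-bearing (recorded, NOT filed — its head is outside this LD cone and D-0019 forbids a
rival family for 10967/X inside the route): L²-wall (shape of shared 10952) ⇐ M1 ∧
DensityContinuity, DensityContinuity := the finite-window kinetic Green–Kubo functional W_N(s,σ) =
s·Var_G(window-s average of F)/(N+1) is Cauchy in σ → 0⁺ UNIFORMLY in s (expected true in d = 3 —
Enskog expansion, integrable t^(−3/2) stress-autocorrelation tail — false in d = 2, where W ~ log s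
at fixed density); both premises are load-bearing and the swap's whole difficulty sits in
DensityContinuity; the missing third leaf towards THIS cone is the LD upgrade (b). Natural home: a
route or conjunct whose deciding cone contains a covariance-level statement (fluctuating
hydrodynamics / Green–Kubo coefficients of the dilute hard-sphere gas). Constants κ (≤ κ*/81), T(δ),
R(T), L(R), λ, N₀; milestones: s₀(η, g), σ₀(s).
CHEAPEST FALSIFIER. (i) Ideal-gas control (paper): at σ = 0 every particle flies freely, T⁻¹∫₀ᵀ
g(v_i) = g(v_i), and the cell pressure is n·log E_γ e^(2cg) ≈ 2c²κ²Var(g)·n ≰ δL³ for n ≍ L³ — the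
core is FALSE without collisions (interaction effect, the typed shadow is IdealGasNoDecay of
MourreKoopmanCharges); consistently, milestone M1's window h = sℓ/(σ²√θ) degenerates as σ → 0 at
fixed N, which is why N → ∞ comes first (its ∀N and N₀-before-s mutations are refuted in the tree,
Theorems/BoltzmannGreenKubo/Negative). (ii) Kit / MD — RUN 2026-08-16 by the standing disprover of
M2 (cdisprove-14136; kit jobs j013779, j013786, j013789, j013797, j013800; event-driven MD on the
unit torus at fixed reduced density, n = 125, 512, 1000, 2197, σ ∈ {0.2, 0.3}, cutoff A ∈ {1, ∞}, φ
= 1; table in Cruxes/ShearStressHalfDrude/Disproof.lean §5): collision rate/Boltzmann = 1.013–1.044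
(Enskog χ), stress ACF = exp(−t/τ_η) with τ_η = 1.27 t_mf to 2–5 %, half-variance window S½ =
0.44–0.52 t₀ for EVERY n, σ, A (prediction r_B = ½ at 0.458 t₀), NO PLATEAU (r(4t₀) ≈ 0.07–0.11 ≈
r_B = 0.086), S·r(S) levels at the Green–Kubo value, uniform over a factor 17.6 in N — M1, M2 and
the L² wall pass; still to run: the Green–Kubo-plateau-vs-Enskog leg for the re-orthogonalised heat
flux and the exponential-moment leg (c = 1, κ = 0.1: the LD upgrade). Protocol: r(S) = Var(Σ_i
S⁻¹∫₀^S g)/(n·Var g) for the cutoff shear stress and the re-orthogonalised heat flux, S = 0.1…10 t₀,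
canonical Gibbs start, σ = 0.1–0.3 at unit number density (volume fraction 0.05–1.4 %); predictions
r(S) ≈ 2τ_η/S beyond S ≳ 3τ_η, τ_η ≈ 0.18 t₀ (r ≤ ½ from S ≈ 0.55 t₀ — the M2 window), S·r(S) →
2⟨g,(−L)⁻¹g⟩/‖g‖² × (1 + O(σ³)) (the M1 plateau = the Boltzmann viscosity in Green–Kubo form for the
shear stress, compared with hard-sphere MD since AlderWainwright1970); a PLATEAU r(S) → r_∞ > 0, or
a GK plateau off by more than the Enskog factor, parks the route. (iii) Lookup (page level on the
arXiv texts of BGSSCPAM2023 and BodineauEtAl2024): a printed uniform-in-N (domain → ∞ in mean free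
paths) version of BGSS Thm 1.2, or a fixed-density decorrelation theorem for hard spheres, would
make M1 resp. the core 'known' — none found; BGSS state Thm 1.2 on the unit periodic box in the
joint Boltzmann–Grad limit only.
NUMBERS. Units: ℓ = (N+1)^(-1/3), thermal speed √θ; kinetic unit t₀ = ℓ/(σ²√θ) = 1/(n d²√θ) (n =
N+1, d = σℓ) = 4√π ≈ 7.09 mean free times (t_mf = ℓ/(4√πσ²√θ)); BGSS's ε ↔ ε_eff = d/λ_mf = √2πσ³ ≈
4.44σ³ (0.0044 at σ = 0.1); macroscopic window h = τℓ = (τσ²√θ) t₀. Linearised-Boltzmann window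
fraction for a mode of rate λ: r_B(x) = 2(x − 1 + e^(−x))/x², x = λS: 0.949 (x = 0.16, Lanford
radius ≈ 0.2 t_mf for the shear mode), 0.568 (2), 0.446 (3.1), 0.377 (4), 0.18 (10); one-body
single-lag corrector floor (1 + e^(−x))/2: 0.926, 0.568, 0.523, 0.509, 0.500 — never below ½
(VarianceCertificate's Minkowski 2 can be traded for (1+η, 1+1/η)); shear relaxation τ_η ≈ 1.27 t_mf
≈ 0.18 t₀; GK tail |sV_B(s) − 2GK| ≤ 2‖g‖²/(λ²s); certificate constants 2, 4/h, 2, 8; energy-shell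
floors κ < 0.977 (10967), < 0.489 (X); chessboard 27 colours ⇒ κ_torus = κ_core/81; dense cells n ≤
2L³; cost clause τ₀ ≥ 2κT/δ. Items (rev 13, unchanged since rev 12): 13 = 1 target (0766 shared) + 5
cruxes (14135 X, 10967 shared, 9282 shared, 13915 core, 13916 locality; the shared two staffed
through FluxGibbsianityLdDrude) + 6 supports (14137, 14138, 14139, 14140, 9621 shared — all PROVED —
and 13917, open) + 1 assembly (9240 shared, ledger-closed pre-retype, not a hypothesis); milestones
outside the items: 13985 (M1), 14136 (M2). `closes` since rev 12 (term re-elaborated rev 13):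
hypotheses X, 14139 (PROVED), 9282; item cone X, 14139, 10967, 9282, 0766 + the imported entropy
theorem + `HydrodynamicLimit.of_unguarded` (Statement.lean); open leaves X (or 13916 ∧ 13915 via
13917), 9282.
DEFINITION REQUESTS. None: LocalForecastCorrector landed (gen 0); milestone M1 is stated over the
in-tree `hardSphereLinearizedOp` / `dirichletFormInv` with PROVED gap and Dirichlet-form facts; this
route's dependency cone has 0 unproved project constants (the 4 'unproved cone facts' a repair
payload lists are the summit's own conjunct constants arriving through the gate-written `import
Summits.AtomisticToContinuum.Statement`, not dependencies).

Novelty: Searches RUN (gen 2, 2026-08-15 23Z): `lit read arxiv:2012.03813` (BGSSCPAM2023, materialised 29 pp;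
Thm 1.1 p. 4 verbatim: covariance of the equilibrium fluctuation field → linearised Boltzmann, test
functions in L²_M, periodic box, d ≥ 3, Boltzmann–Grad μ_ε = ε^(−(d−1)); 't diverging slowly with ε,
as o((log|log ε|)^(1/4))'); `lit read arxiv:2201.04514` (BodineauEtAl2024 AoP, 49 pp; Thm 1.1 short
time [BLLS80, BGSS3], Thm 1.2 = long-time covariance for all t, Thm 1.3 + Rem. 1.3 moments on O(log
log|log ε|), ref [BGSS4] 'from the atomistic description to fluctuating hydrodynamics'); `ledger bib
get` on BGSSCPAM2023, BGSSAnnals2023, BodineauEtAl2024, VanbeijerenEtAl1980, BarangerMouhot2005,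
LutskoToth2020, DengHaniMa2024, GallavottiLanfordLebowitz1970, Alexander1976,
BodineauGallagherSaintRaymondInvent2016 (all present); `lean search` of the in-tree kinetic side
(hardSphereLinearizedOp, dirichletFormInv,
le_neg_maxwellianInner_hardSphereLinearizedOp_of_orthogonal_holds PROVED,
dirichletFormInv_pos/bddAbove _holds PROVED); the barrier catalogue re-read at page level
(NoDensityExpansionNarrow items 1–5, DiluteRegimeBarrier(-Narrow), BoltzmannHypothesis(-Narrow),
VelocityReversalNarrow); the sibling route files TwoClocks, AlphaScalingLadder, RelayRaceLocality,
FluxGibbsianityLdDrude, StiffCollisionalRelaxation (136 Theses in the sub); `ledger negatives` (12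
refuted statements, none touched). `lit search --source local|arxiv` and galaxy were
unavailable/rate-limited this session  [refs: 2012.03813, 2201.04514, 2011.00611, arxiv:2012.03813, arxiv:2201.04514, BGSSCPAM2023, BodineauEtAl2024, BGSSAnnals2023, VanbeijerenEtAl1980, BarangerMouhot2005, LutskoToth2020, DengHaniMa2024, GallavottiLanfordLebowitz1970, Alexander1976, BodineauGallagherSaintRaymondInvent2016, Spohn1991, KipnisLandim1999, Ruelle1969, BernardinHuveneers2013, MarchioroPellegrinottiPresutti1975, PulvirentiTsagkarog]

Barriers (technique_class: variational-certificate drude-weight locality green-kubo): - technique_class: variational-certificate drude-weight locality-transfer kinetic-window-green-kubo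
- Literature.Barriers.AtomisticToContinuum.BoltzmannHypothesisBarrier: its proved kernel (free
flight preserves EVERY velocity law) is exactly where the core FAILS: at σ = 0, T⁻¹∫₀ᵀ g(v_i) =
g(v_i) and the cell pressure is ≈ 2c²κ²Var(g)·n ≰ δL³ — the line consumes an INTERACTION effect,
never the classification of stationary states recorded as unavailable; the barrier's objects are
invariant STATES of the infinite system, ours equal-time Gibbs integrals plus ONE finite cluster
over a fixed horizon.
- Literature.Barriers.AtomisticToContinuum.BoltzmannHypothesisBarrierNarrow: met head-on at the flux
level — X → 10967 is the flux-level closure in LD currency; caveat (c) lists finite-volume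
substitutes as NOT covered; ours avoids every refuted feature of ChaoticMixing (free cluster,
horizon fixed before volume, small-amplitude LD functional, no shell-uniform rates); the bet (caveat
(b): absence of proof) is kinetic-time decorrelation of dilute clusters at fixed σ, whose
dilute-corner shadow is now a typed theorem-grade rung (BoltzmannGreenKubo).
- Literature.Barriers.AtomisticToContinuum.MacroErgodicityBarrier: not consumed — no invariant state
of an infinite dynamics is classified, no sector condition is needed at Euler scale; the H₋₁/gap
step of the nongradient method becomes exact Jensen under G_N plus static localisation.
- Literature.Barriers.AtomisticToContinuum.MazurBoundBal

History (route lifecycle, newest last):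
- 2026-08-15T22:53:08Z · rev 5: dropped stmt-AtomisticToContinuum-13584, stmt-AtomisticToContinuum-13586 — promote-to-A (2a/3): drop the two informal items refuted-MISSTATED on paper by four refuter passes (13584 CollisionTreeCorrectors: sharp-cutoff isolated forecas (planner-promote-AtomisticToContinuum-AntiMazur-64c9a614-0)
- 2026-08-15T23:31:57Z · rev 7: dropped FastObservableMeanErgodic — promote-to-A gen 2 (1/3): drop the shared support FastObservableMeanErgodic (stmt-10952; it stays wanted by FluxGibbsianityLdDrude) from THIS route to make room (planner-promote-AtomisticToContinuum-AntiMazur-64c9a614-g2-0)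
- 2026-08-16T06:34:01Z · rev 11: dropped BoltzmannGreenKubo, ShearStressHalfDrude — route-repair (unused-crux; unit rrepair-AtomisticToContinuum-AntiMazur-1b890977): DROP the two L² rungs BoltzmannGreenKubo (stmt-13985) and ShearStressHalfDrude (planner-rrepair-AtomisticToContinuum-AntiMazur-1b890977-0)
- 2026-08-17T15:41:47Z · CLOSED superseded — superseded:route-AtomisticToContinuum-FluxGibbsianityLdDrude (planner-rbadge-AtomisticToContinuum-AntiMazurC-64c9a614-g2-0)

sub-problem: HydrodynamicLimit · status: closed(superseded) · opened planner-plancard-AtomisticToContinuum-Hydrody-c1a68937-g2-0 2026-08-15T19:06:18Z · rev 14 · ledger route-AtomisticToContinuum-AntiMazurCoboundaries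
GENERATED by the gate from the ledger (D-0016/17). Provers cite these decls: `theorem foo : Summit.AtomisticToContinuum.HydrodynamicLimit.Theses.AntiMazurCoboundaries.<Decl> := …` in Summits/AtomisticToContinuum/HydrodynamicLimit/Theorems/<Name>.lean.
-/

namespace Summit.AtomisticToContinuum.HydrodynamicLimit.Theses.AntiMazurCoboundaries

open scoped BigOperators Topology Manifold Classical MeasureTheory ProbabilityTheory Matrix InnerProductSpace ComplexConjugate ContinuousMap
open Filter Set Function TopologicalSpace MeasureTheory

attribute [summit_statement] _root_.HydrodynamicLimit

/-- item stmt-AtomisticToContinuum-0766 · target · rank 0 · open · by planner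
why it might fail: Entropy production >= cN before the first shock for some smooth data (non-Gibbsian mesoscopic structure of deterministic spheres at fixed reduced density) refutes it and every Yau-family route; OllaVaradhanYau1993 Thm 2.1 needs velocity noise exactly here and nothing replaces it at fixed sigma.
sources: Yau1991, OllaVaradhanYau1993, Spohn1991, DengHaniMa2024
[target] X_RE: for all continuous profiles ∃ σ₀ ∀ σ<σ₀ ∀ classical hs-Euler solutions on [0,T) ∀
flows: the initial local Gibbs laws are probability measures and, if their fields converge at t=0,
then ∀ t<T ∃ activity profile a_t such that the reference local Gibbs law (a_t, u_t, θ_t) is a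
probability measure whose empirical density/momentum/energy fields concentrate exponentially (≤ C
e^{-(N+1)/C}) around (ρ,ρu,E)(t), and klDiv(lawAt Φ_N (localGibbs a₀u₀θ₀) t ‖ localGibbs a_t u_t
θ_t)/(N+1) → 0. Yau1991; OllaVaradhanYau1993 Thm 1.1 (with noise). -/
@[route_item "route-AtomisticToContinuum-AntiMazurCoboundaries"]
def RelEntropyVanishing : Prop :=
  ∀ (a₀ θ₀ : Literature.MathematicalPhysics.KineticTheory.T3 → ℝ) (u₀ : Literature.MathematicalPhysics.KineticTheory.T3 → Literature.MathematicalPhysics.KineticTheory.V3), Continuous a₀ → Continuous θ₀ → Continuous u₀ → (∀ x, 0 < a₀ x) → (∀ x, 0 < θ₀ x) → ∃ σ₀ : ℝ, 0 < σ₀ ∧ ∀ σ : ℝ, 0 < σ → σ < σ₀ → ∀ (T : ℝ) (ρ θ : ℝ → Literature.MathematicalPhysics.KineticTheory.T3 → ℝ) (u : ℝ → Literature.MathematicalPhysics.KineticTheory.T3 → Literature.MathematicalPhysics.KineticTheory.V3), Literature.MathematicalPhysics.KineticTheory.IsHardSphereEulerSolution σ T ρ u θ → ∀ Φ : (N : ℕ)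 → Literature.Analysis.FluidPDE.HardSphereFlow (Literature.Analysis.FluidPDE.Torus.geometry (Fin 3)) (Literature.MathematicalPhysics.KineticTheory.hsDiameter σ N) (N + 1), (∀ N, MeasureTheory.IsProbabilityMeasure (Literature.MathematicalPhysics.KineticTheory.localGibbsLaw σ a₀ u₀ θ₀ N (Φ N))) ∧ (Literature.MathematicalPhysics.KineticTheory.TendstoHydroFieldsAt (fun N => Literature.MathematicalPhysics.KineticTheory.localGibbsLaw σ a₀ u₀ θ₀ N (Φ N)) Φ ρ u θ 0 → ∀ t ∈ Set.Ico 0 T, ∃ a : Literature.MathematicalPhysics.KineticTheory.T3 → ℝ, (∀ N, MeasureTheory.IsProbabilityMeasure (Literature.MathematicalPhysics.KineticTheory.localGibbsLaw σ a (u t) (θ t) N (Φ N))) ∧ (∀ χ : Literature.MathematicalPhysics.KineticTheory.T3 → ℝ, Continuous χ → ∀ δ : ℝ, 0 < δ → ∃ C : ℝ, 0 < C ∧ ∀ N : ℕ, Literature.MathematicalPhysics.KineticTheory.localGibbsLaw σ a (u t) (θ t) N (Φ N) {z | δ < |Literature.MathematicalPhysics.KineticTheory.empiricalDensityField z χ -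 ∫ x, χ x * ρ t x|} ≤ ENNReal.ofReal (C * Real.exp (-(C⁻¹ * (N + 1)))) ∧ Literature.MathematicalPhysics.KineticTheory.localGibbsLaw σ a (u t) (θ t) N (Φ N) {z | δ < ‖Literature.MathematicalPhysics.KineticTheory.empiricalMomentumField z χ - ∫ x, (χ x * ρ t x) • u t x‖} ≤ ENNReal.ofReal (C * Real.exp (-(C⁻¹ * (N + 1)))) ∧ Literature.MathematicalPhysics.KineticTheory.localGibbsLaw σ a (u t) (θ t) N (Φ N) {z | δ < |Literature.MathematicalPhysics.KineticTheory.empiricalEnergyField z χ - ∫ x, χ x * Literature.MathematicalPhysics.KineticTheory.totalEnergyDensity (ρ t x) (u t x) (θ t x)|} ≤ ENNReal.ofReal (C * Real.exp (-(C⁻¹ * (N + 1))))) ∧ Filter.Tendsto (fun N : ℕ => InformationTheory.klDiv ((Φ N).lawAt (Literature.MathematicalPhysics.KineticTheory.localGibbsLaw σ a₀ u₀ θ₀ N (Φ N)) t) (Literature.MathematicalPhysics.KineticTheory.localGibbsLaw σ a (u t) (θ t) N (Φ N)) / ((N : ENNReal) + 1)) Filter.atTop (nhds 0))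

/-- item stmt-AtomisticToContinuum-14135 · crux · rank 2 · closed · moot by None · by planner
why it might fail: ⇔ shared 10967 (refuter-certified). Any certificate proof of a Drude fraction θ needs kinetic control up to ≍2/(λθ): δ → 0 at FIXED σ asks an infinite validity horizon at fixed density, beyond all printed ones (BGSS o((log|log ε|)^¼), LutskoToth r⁻²); false iff a uniform-in-N Drude weight survives.
sources: KipnisLandim1999, OllaVaradhanYau1993, BGSSCPAM2023, BodineauEtAl2024, LutskoToth2020, Spohn1991
[crux] EXPONENTIAL ANTI-MAZUR (card crux K1 at the LD level; the route's X): for constant profiles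
(a, u₀, θ) and σ < σ₀ the global Gibbs laws G_N are probability measures and there is an amplitude κ
> 0 such that for all continuous φ, g with |φ| ≤ 1, |g| ≤ κ, g ⊥ span(1, v, |v|²) in L²(stdGaussian)
and every δ > 0 there are τ₀ > 0, N₀ with: for N ≥ N₀ and every hard-sphere flow Φ there exist lag >
0 and a bounded measurable W on phase space with ∫ exp(2(F − lag⁻¹(W∘Φ.flow lag − W))) dG_N ≤
e^(δ(N+1)) and ∫ exp(4 h₀⁻¹ |W|) dG_N ≤ e^(δ(N+1)), h₀ = τ₀(N+1)^(-1/3), F(z) = Σ_i φ(x_i)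
g((v_i−u₀)/√θ). Gen-1 item 5895 with the orthogonality clause unfolded to Mathlib (cone-clean,
byte-identical frame to 10967); refuter-certified consistent: W = 0, transport and telescoping
correctors fail for small δ, the ∃κ clause is necessary (energy-shell Donsker–Varadhan floor: κ <
0.489 for a two-level radial g), and the item is equivalent in strength to 10967 (discrete Fejér
corrector ⇐, ExponentialCertificate ⇒) — the corrector is the attack surface, not a weakening.
[difficulty: open-problem] -/
@[route_item "route-AtomisticToContinuum-AntiMazurCoboundaries"]
def CorrectorPressureDecay : Prop :=
  ∀ (a θ : ℝ) (u₀ : Literature.MathematicalPhysics.KineticTheory.V3), 0 < a → 0 < θ → ∃ σ₀ : ℝ, 0 < σ₀ ∧ ∀ σ : ℝ, 0 < σ → σ < σ₀ → (∀ (N : ℕ) (Φ : Literature.Analysis.FluidPDE.HardSphereFlow (Literature.Analysis.FluidPDE.Torus.geometry (Fin 3)) (Literature.MathematicalPhysics.KineticTheory.hsDiameter σ N) (N + 1)), MeasureTheory.IsProbabilityMeasure (Literature.MathematicalPhysics.KineticTheory.localGibbsLaw σ (fun _ => a) (fun _ => u₀) (fun _ => θ) N Φ)) ∧ ∃ κ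 : ℝ, 0 < κ ∧ ∀ (φ : Literature.MathematicalPhysics.KineticTheory.T3 → ℝ) (g : Literature.MathematicalPhysics.KineticTheory.V3 → ℝ), Continuous φ → Continuous g → (∀ x, |φ x| ≤ 1) → (∀ v, |g v| ≤ κ) → (∀ (c₀ c₂ : ℝ) (b : Literature.MathematicalPhysics.KineticTheory.V3), ∫ v, g v * (c₀ + inner ℝ b v + c₂ * ‖v‖ ^ 2) ∂(ProbabilityTheory.stdGaussian Literature.MathematicalPhysics.KineticTheory.V3) = 0) → ∀ δ : ℝ, 0 < δ → ∃ τ₀ : ℝ, 0 < τ₀ ∧ ∃ N₀ : ℕ, ∀ N : ℕ, N₀ ≤ N → ∀ Φ : Literature.Analysis.FluidPDE.HardSphereFlow (Literature.Analysis.FluidPDE.Torus.geometry (Fin 3)) (Literature.MathematicalPhysics.KineticTheory.hsDiameter σ N) (N + 1), ∃ lag : ℝ, 0 < lag ∧ ∃ W : Literature.Analysis.FluidPDE.Config (N + 1) (Fin 3) Literature.MathematicalPhysics.KineticTheory.T3 → ℝ, Measurable W ∧ (∃ C : ℝ, ∀ z, |W z| ≤ C) ∧ ∫⁻ z, ENNReal.ofReal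 (Real.exp (2 * ((∑ i, φ (z i).1 * g ((Real.sqrt θ)⁻¹ • ((z i).2 - u₀))) - lag⁻¹ * (W (Φ.flow lag z) - W z)))) ∂(Literature.MathematicalPhysics.KineticTheory.localGibbsLaw σ (fun _ => a) (fun _ => u₀) (fun _ => θ) N Φ) ≤ ENNReal.ofReal (Real.exp (δ * (N + 1))) ∧ ∫⁻ z, ENNReal.ofReal (Real.exp (4 * (τ₀ * ((N + 1 : ℕ) : ℝ) ^ (-(1 / 3 : ℝ)))⁻¹ * |W z|)) ∂(Literature.MathematicalPhysics.KineticTheory.localGibbsLaw σ (fun _ => a) (fun _ => u₀) (fun _ => θ) N Φ) ≤ ENNReal.ofReal (Real.exp (δ * (N + 1)))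

/-- item stmt-AtomisticToContinuum-10967 · crux · rank 4 · open · by planner
why it might fail: A finite-entropy translation- and time-invariant state of infinite 3-d hard spheres with non-Maxwellian one-body velocity law gives Lambda_infty > 0 (free gas, d=1 rods are exact witnesses); the amplitude clause is necessary (kappa < 0.977); no uniform-in-N LD decay known outside Boltzmann-Grad.
sources: OllaVaradhanYau1993, Spohn1991, TothValko2003, Kifer1990, LepriLiviPoliti2003, BGSSAnnals2023
[crux] LD-DRUDE VANISHING FOR FAST KINETIC OBSERVABLES (card ld-drude-flux-gibbsianity, step 1,
kinetic part; = finite-N LD form of kinetic flux-Gibbsianity). For every activity a > 0, temperature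
θ > 0, drift u₀ there is σ₀ > 0 such that for 0 < σ < σ₀ the constant-profile local Gibbs laws G_N =
localGibbsLaw σ a u₀ θ (global Gibbs; flow-invariant) are probability measures and there is an
amplitude κ > 0 with: for all continuous φ : 𝕋³ → ℝ with |φ| ≤ 1 and continuous g : ℝ³ → ℝ with |g|
≤ κ and g ⊥ collisionInvariants (maxwellianInner g ψ = 0 for ψ ∈ span{1, v, |v|²}, i.e. ∫ g ψ d
stdGaussian = 0), for every δ > 0 there are τ > 0 and N₀ with, for all N ≥ N₀ and EVERY hard-sphere
flow Φ of N+1 spheres of diameter σ(N+1)^{-1/3} on 𝕋³: ∫ exp( h⁻¹ ∫_0^h Σ_i φ(x_i(s)) g((v_i(s) −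
u₀)/√θ) ds ) dG_N ≤ exp(δ (N+1)), h = τ (N+1)^{-1/3} (a kinetic window: τ × O(1) mean free times,
macroscopically → 0). Equivalently Λ_∞(φ⊗g) := inf_τ limsup_N (N+1)⁻¹ log E_{G_N} e^{…} = 0 (Λ_τ ≥ 0
by Jensen since the mean is 0; τΛ_τ is subadditive by Hölder + invariance, so inf = lim). Covers the
truncated traceless stress g = J:(w⊗w − |w|²/3)𝟙_{|w|≤A} and the truncated re-orthogonalised heat
flux. The ampli -/
@[route_item "route-AtomisticToContinuum-AntiMazurCoboundaries", crux]
def KineticFluxLdDecay : Prop :=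
  ∀ (a θ : ℝ) (u₀ : Literature.MathematicalPhysics.KineticTheory.V3), 0 < a → 0 < θ → ∃ σ₀ : ℝ, 0 < σ₀ ∧ ∀ σ : ℝ, 0 < σ → σ < σ₀ → (∀ (N : ℕ) (Φ : Literature.Analysis.FluidPDE.HardSphereFlow (Literature.Analysis.FluidPDE.Torus.geometry (Fin 3)) (Literature.MathematicalPhysics.KineticTheory.hsDiameter σ N) (N + 1)), MeasureTheory.IsProbabilityMeasure (Literature.MathematicalPhysics.KineticTheory.localGibbsLaw σ (fun _ => a) (fun _ => u₀) (fun _ => θ) N Φ)) ∧ ∃ κ : ℝ, 0 < κ ∧ ∀ (φ : Literature.MathematicalPhysics.KineticTheory.T3 → ℝ) (g : Literature.MathematicalPhysics.KineticTheory.V3 → ℝ), Continuous φ → Continuous g → (∀ x, |φ x| ≤ 1) → (∀ v, |g v| ≤ κ) → (∀ (c₀ c₂ : ℝ) (b : Literature.MathematicalPhysics.KineticTheory.V3), ∫ v, g v * (c₀ + inner ℝ b v + c₂ * ‖v‖ ^ 2) ∂(ProbabilityTheory.stdGaussian Literature.MathematicalPhysics.KineticTheory.V3) = 0) → ∀ δ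 : ℝ, 0 < δ → ∃ τ : ℝ, 0 < τ ∧ ∃ N₀ : ℕ, ∀ N : ℕ, N₀ ≤ N → ∀ Φ : Literature.Analysis.FluidPDE.HardSphereFlow (Literature.Analysis.FluidPDE.Torus.geometry (Fin 3)) (Literature.MathematicalPhysics.KineticTheory.hsDiameter σ N) (N + 1), ∫⁻ z, ENNReal.ofReal (Real.exp ((τ * ((N + 1 : ℕ) : ℝ) ^ (-(1 / 3 : ℝ)))⁻¹ * ∫ s in (0 : ℝ)..(τ * ((N + 1 : ℕ) : ℝ) ^ (-(1 / 3 : ℝ))), ∑ i, φ (Φ.flow s z i).1 * g ((Real.sqrt θ)⁻¹ • ((Φ.flow s z i).2 - u₀)))) ∂(Literature.MathematicalPhysics.KineticTheory.localGibbsLaw σ (fun _ => a) (fun _ => u₀) (fun _ => θ) N Φ) ≤ ENNReal.ofReal (Real.exp (δ * (N + 1)))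

/-- item stmt-AtomisticToContinuum-9282 · crux · rank 5 · open · by planner
why it might fail: Its proof must supply two inputs NOT among the decl's hypotheses (LD decay of the COLLISIONAL momentum/energy flux; exp. velocity tails under the true law) and pay O(h_N N) entropy per kinetic window over T/h_N windows (O(N) total) to move exp. moments from invariant G_N to psi_t; OVY1993 use noise.
sources: Yau1991, OllaVaradhanYau1993, KipnisLandim1999, Spohn1991
[crux] KINETIC-WINDOW RELATIVE-ENTROPY METHOD (card step 2, sufficiency half of the duality;
companion card kinetic-windows-inside-yau): KineticFluxLdDecay → RelEntropyVanishing. With f_t the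
true time-t law (lawAt Φ_N of the local Gibbs datum) and ψ_t the local Gibbs reference driven by the
classical hs-Euler solution, integrate dH_N(f_t|ψ_t)/dt over kinetic windows [t, t + h_N], h_N =
τ(N+1)^{-1/3}: positions move O(h_N), the integrand is Σ_i ∇λ(t, x_i) · (window-averaged microscopic
current − Euler flux at the reference) + ∂_t log-partition terms; split the current into (kinetic
part orthogonal to the collision invariants in the local frame) + (collisional transfer minus linear
EOS response) + (conserved-field part, cancelled by the Euler equations for λ as in Yau1991) +
(high-velocity tail); bound the first by the entropy inequality ∫X df ≤ β⁻¹[H(f|ψ) + log ∫ e^{βX}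
dψ] with log ∫ e^{βX} dψ_t ≤ N(Λ_τ + o(1)) after LOCALISING the exponential moment from the
invariant G_N (constant profiles, where KineticFluxLdDecay applies) to ψ_t (window entropy
production O(h_N N), block freezing of λ), the second by CollisionalFluxLdDecay (informal crux of
this route, GIVEN), the tail by a tr -/
@[route_item "route-AtomisticToContinuum-AntiMazurCoboundaries"]
def KineticWindowGronwall : Prop :=
  KineticFluxLdDecay → RelEntropyVanishing

/-- item stmt-AtomisticToContinuum-13915 · crux · rank 6 · closed · moot by None · by planner
why it might fail: After the chessboard step the residual object is a Boltzmann–Grad gas (ε_eff = √2πσ³) on fixed-size blocks with any boundary data, but T → ∞ at FIXED ε_eff exceeds every printed horizon (o((log|log ε|)^¼), r⁻²); false iff a bulk LD-Drude weight of dilute spheres exists; n ≤ 2L³ uniformity may break.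
sources: BGSSCPAM2023, BodineauEtAl2024, BGSSAnnals2023, LutskoToth2020, VanbeijerenEtAl1980, Spohn1991 Thm 7.3 p. 100 (PDF p0107)
[crux] THE N-FREE CORE (NEW typed layer-2 child of CorrectorPressureDecay, 2026-08-15 promote-to-A =
the normal form of the route's X after LocalCertificateTransfer): for σ < σ₀ there is an amplitude κ
> 0 such that for every continuous g : ℝ³ → ℝ with |g| ≤ κ, g ⊥ span(1, v, |v|²) in L²(stdGaussian),
and every δ > 0 there are a horizon T and a range R₀ with: for all R ≥ R₀ there is L₀ such that for
every cube Q_L = [0,L]³ ⊂ ℝ³ (L ≥ L₀), every particle number n ≤ 2L³, every family Ψ of Euclidean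
hard-sphere flows (diameter σ) and every |c| ≤ 1: ∫ exp(2c Σ_{i<n} T⁻¹∫₀ᵀ g(velocity of
localClusterState Ψ R t z i) dt) dP_{n,L} ≤ e^(δL³), where P_{n,L} = particleLaw (canonicalDensity
(Euclidean.geometry) σ n (1_{Q_L}(x)·M(v))) is the canonical Gibbs law of n spheres of diameter σ
with positions uniform in Q_L (hard core) and standard Maxwellian velocities (units: interparticle
distance 1 = the torus ℓ, θ = 1, u₀ = 0 — the transfer rescales and lifts). In words: window-T time
averages of a fast one-body observable along the R-LOCAL FORECASTS of a Gibbs-distributed finite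
cluster have pressure o(volume) once T is large, uniformly in the cluster size at density ≤ 2. ONE
finite Hamiltonian -/
@[route_item "route-AtomisticToContinuum-AntiMazurCoboundaries"]
def CellForecastPressureDecay : Prop :=
  ∃ σ₀ : ℝ, 0 < σ₀ ∧ ∀ σ : ℝ, 0 < σ → σ < σ₀ → ∃ κ : ℝ, 0 < κ ∧ ∀ g : Literature.MathematicalPhysics.KineticTheory.V3 → ℝ, Continuous g → (∀ v, |g v| ≤ κ) → (∀ (c₀ c₂ : ℝ) (b : Literature.MathematicalPhysics.KineticTheory.V3), ∫ v, g v * (c₀ + inner ℝ b v + c₂ * ‖v‖ ^ 2) ∂(ProbabilityTheory.stdGaussian Literature.MathematicalPhysics.KineticTheory.V3) = 0) → ∀ δ : ℝ, 0 < δ → ∃ T : ℝ, 0 < T ∧ ∃ R₀ : ℝ, 0 < R₀ ∧ ∀ R : ℝ, R₀ ≤ R → ∃ L₀ : ℝ, 0 < L₀ ∧ ∀ L : ℝ, L₀ ≤ L → ∀ n : ℕ, (n : ℝ) ≤ 2 * L ^ 3 → ∀ (Ψ : (k : ℕ) → Literature.Analysis.FluidPDE.HardSphereFlow (Literature.Analysis.FluidPDE.Euclidean.geometry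 (Fin 3)) σ k) (c : ℝ), |c| ≤ 1 → ∫⁻ z, ENNReal.ofReal (Real.exp (2 * c * ∑ i : Fin n, T⁻¹ * ∫ t in (0 : ℝ)..T, g (Literature.Analysis.FluidPDE.localClusterState Ψ R t z i).2)) ∂(Literature.Analysis.FluidPDE.particleLaw (Ψ n) (Literature.Analysis.FluidPDE.canonicalDensity (Literature.Analysis.FluidPDE.Euclidean.geometry (Fin 3)) σ n (fun p => Set.indicator {x : Literature.MathematicalPhysics.KineticTheory.V3 | ∀ k, x k ∈ Set.Icc (0 : ℝ) L} (fun _ => (1 : ℝ)) p.1 * Literature.Analysis.FluidPDE.globalMaxwellian p.2))) ≤ ENNReal.ofReal (Real.exp (δ * L ^ 3))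

/-- item stmt-AtomisticToContinuum-13916 · crux · rank 7 · closed · moot by None · by planner
why it might fail: The LD form needs the cost per corrupted forecast → ∞ as R → ∞ at FIXED T; collision cascades or Newton's-cradle chains of near-contacts may cap it (repair: first-moment form E#bad/(N+1) → 0 — all that BoltzmannGreenKubo and ShearStressHalfDrude consume).
sources: Alexander1976, MarchioroPellegrinottiPresutti1975, CagliotiMarchioroPulvirenti2000, DobrushinFritz1977, Sinai1972, Spohn1991 Thm 1.2 p. 12 (PDF p0019)
[crux] FINITE SPEED OF INFLUENCE, UNIFORMLY IN N, IN EXPONENTIAL MOMENTS (NEW typed layer-2 child of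
CorrectorPressureDecay, 2026-08-15 promote-to-A; the locality half of LocalCertificateTransfer; the
route's Monday-morning item). Setting of CorrectorPressureDecay (global Gibbs G_N = localGibbsLaw σ
a u₀ θ, constant profiles, σ < σ₀; N+1 spheres of diameter σℓ on 𝕋³, ℓ = (N+1)^(-1/3), horizon Tℓ
and range Rℓ in these units). Particle i is BAD if at some t ∈ [0, Tℓ] its true state (Φ.flow t z) i
differs from its LOCAL FORECAST localClusterState Ψ (Rℓ) t z i — its state if only the particles
initially within torus distance Rℓ of x_i are evolved, under their isolated hard-sphere dynamics Ψ k
(tree: Literature/Analysis/FluidPDE/LocalForecastCorrector.lean, definition LocalForecastCorrector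
LANDED). CLAIM: ∀ T, lam, δ > 0 ∃ R, N₀: for N ≥ N₀, every flow Φ and every family Ψ of cluster
flows, ∫ exp(lam · #{bad i}) dG_N ≤ e^(δ(N+1)). Content: influence travels only along time-ordered
collision chains, whose reach within Tℓ is ≤ (chain kinetic energy)^(1/2)·Tℓ; hard-core packing
bounds the number of spheres in a ball deterministically; velocities are Maxwellian under G_N at
every time (Hom -/
@[route_item "route-AtomisticToContinuum-AntiMazurCoboundaries"]
def InfluenceLocality : Prop :=
  ∀ (a θ : ℝ) (u₀ : Literature.MathematicalPhysics.KineticTheory.V3), 0 < a → 0 < θ → ∃ σ₀ : ℝ, 0 < σ₀ ∧ ∀ σ : ℝ, 0 < σ → σ < σ₀ → ∀ (T lam δ : ℝ), 0 < T → 0 < lam → 0 < δ → ∃ R : ℝ, 0 < R ∧ ∃ N₀ : ℕ, ∀ N : ℕ, N₀ ≤ N → ∀ (Φ : Literature.Analysis.FluidPDE.HardSphereFlow (Literature.Analysis.FluidPDE.Torus.geometry (Fin 3)) (Literature.MathematicalPhysics.KineticTheory.hsDiameter σ N) (N + 1)) (Ψ : (k : ℕ) → Literature.Analysis.FluidPDE.HardSphereFlow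 (Literature.Analysis.FluidPDE.Torus.geometry (Fin 3)) (Literature.MathematicalPhysics.KineticTheory.hsDiameter σ N) k), ∫⁻ z, ENNReal.ofReal (Real.exp (lam * ((Finset.univ.filter fun i : Fin (N + 1) => ∃ t ∈ Set.Icc (0 : ℝ) (T * ((N + 1 : ℕ) : ℝ) ^ (-(1 / 3 : ℝ))), Φ.flow t z i ≠ Literature.Analysis.FluidPDE.localClusterState Ψ (R * ((N + 1 : ℕ) : ℝ) ^ (-(1 / 3 : ℝ))) t z i).card : ℝ))) ∂(Literature.MathematicalPhysics.KineticTheory.localGibbsLaw σ (fun _ => a) (fun _ => u₀) (fun _ => θ) N Φ) ≤ ENNReal.ofReal (Real.exp (δ * (N + 1)))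

/-- item stmt-AtomisticToContinuum-13917 · support · rank 9 · closed · moot by None · by planner
sources: KipnisLandim1999, PulvirentiTsagkarogiannis2012, GallavottiLanfordLebowitz1970, Ruelle1969, Alexander1976
[support] THE LOCAL-CERTIFICATE TRANSFER (NEW typed glue of the corrected two-layer plan; provable
with named tools, long): InfluenceLocality → CellForecastPressureDecay → CorrectorPressureDecay.
Order of choices δ → T (core) → λ (lag) → lam = 12κ(1 + H/λ) → R ≥ max(R₀(T), R_loc(T+λ, lam, δ)) →
L ≥ L₀(R) → N₀ → τ₀ (no loop: step (5) is N- and cell-free). (1) WITNESS: lag := λℓ (FIXED kinetic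
lag — the refuters' repair C′ of the retired informal CollisionTreeCorrectors, whose 'all small lag'
clause was false because isolated forecasts jump) and W := Fejér local forecast corrector of horizon
H = Tℓ from R-ball isolated forecasts, W(z) = −Σ_i ∫₀ᴴ(1 − t/H) f(localClusterState Ψ (Rℓ) t z i) dt
(tree: localForecastCorrector; |W| ≤ (N+1)κH/2, measurable). (2) EXACT IDENTITY for the true-flow
Fejér corrector W^true (Lipschitz along orbits): F − D_{W^true} = Σ_i S_i + Σ_i B_i, S_i = f_i −
λ-average of f_i∘Φ (within-lag shot noise), B_i = λ-average of the window-H averages of f_i∘Φ. (3)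
ERROR CORRECTOR E = W − W^true lives on bad particles, |D_E| ≤ κ(H/λ)(#bad₀ + #bad_λ);
Cauchy–Schwarz + invariance (HomogeneousInvariance) + InfluenceLocality with lam = 12κ(1 + H/λ). (4)
Hölder splits the de -/
@[route_item "route-AtomisticToContinuum-AntiMazurCoboundaries"]
def LocalCertificateTransfer : Prop :=
  InfluenceLocality → CellForecastPressureDecay → CorrectorPressureDecay

/-- item stmt-AtomisticToContinuum-14137 · support · rank 9 · closed · proved by Summit.AtomisticToContinuum.HydrodynamicLimit.Theorems.exponentialCertificate_proof (prover) · by planner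
sources: KipnisLandim1999, Mazur1969, OllaVaradhanYau1993
[support] THE EXPONENTIAL ANTI-MAZUR CERTIFICATE (provable now; gen-1 5898, refuter-verified with
exact constants): for any hard-sphere flow Φ on 𝕋³, any Φ-invariant probability law μ with μ(goodᶜ)
= 0, bounded measurable F, W, window h > 0 and lag > 0: ∫ exp(h⁻¹∫₀ʰ F(Φ.flow s z) ds) dμ ≤ (∫
exp(2(F − lag⁻¹(W∘Φ.flow lag − W))) dμ)^½ · (∫ exp(4h⁻¹|W|) dμ)^½. Proof: pathwise telescoping
h⁻¹∫₀ʰF∘Φ_s = h⁻¹∫₀ʰ(F − D_W)∘Φ_s + B, B = (h·lag)⁻¹[∫_h^(h+lag) − ∫_0^lag] W∘Φ_u; Cauchy–Schwarz;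
Jensen in s (joint (s,z)-measurability on good from right-continuous orbits:
HardSphereFlow.measurable_piecewise_flow / measurable_uncurry_of_rightContinuous); invariance of μ;
e^(2B) ≤ ½(e^((4/h)avg₁W∘Φ) + e^(−(4/h)avg₂W∘Φ)). [difficulty: provable-now] -/
@[route_item "route-AtomisticToContinuum-AntiMazurCoboundaries"]
def ExponentialCertificate : Prop :=
  ∀ (ε : ℝ) (N : ℕ) (Φ : Literature.Analysis.FluidPDE.HardSphereFlow (Literature.Analysis.FluidPDE.Torus.geometry (Fin 3)) ε (N + 1)) (μ : MeasureTheory.Measure (Literature.Analysis.FluidPDE.Config (N + 1) (Fin 3) Literature.MathematicalPhysics.KineticTheory.T3)), MeasureTheory.IsProbabilityMeasure μ → (∀ t, MeasureTheory.MeasurePreserving (Φ.flow t) μ μ) → μ Φ.goodᶜ = 0 → ∀ (F W : Literature.Analysis.FluidPDE.Config (N + 1) (Fin 3) Literature.MathematicalPhysics.KineticTheory.T3 → ℝ), Measurable F → Measurable W → (∃ C : ℝ, ∀ z, |F z| ≤ C) → (∃ C : ℝ, ∀ z, |W z| ≤ C) → ∀ (h lag : ℝ), 0 < h → 0 < lag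 → ∫⁻ z, ENNReal.ofReal (Real.exp (h⁻¹ * ∫ s in (0 : ℝ)..h, F (Φ.flow s z))) ∂μ ≤ (∫⁻ z, ENNReal.ofReal (Real.exp (2 * (F z - lag⁻¹ * (W (Φ.flow lag z) - W z)))) ∂μ) ^ (1 / 2 : ℝ) * (∫⁻ z, ENNReal.ofReal (Real.exp (4 * h⁻¹ * |W z|)) ∂μ) ^ (1 / 2 : ℝ)

/-- item stmt-AtomisticToContinuum-14138 · support · rank 9 · closed · proved by Summit.AtomisticToContinuum.HydrodynamicLimit.Theorems.antiMazurCoboundaries_varianceCertificate_proof (prover) · by planner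
sources: Mazur1969, Suzuki1971, LepriLiviPoliti2003
[support] THE L² CERTIFICATE (provable now; gen-1 5899, constants 2 and 8 verified): same
hypotheses; ∫ (h⁻¹∫₀ʰ F∘Φ_s ds)² dμ ≤ 2 ∫ (F − lag⁻¹(W∘Φ_lag − W))² dμ + 8 ∫ (h⁻¹ W)² dμ (Minkowski
+ Jensen + invariance; the finite-lag, finite-volume form of D(A) ≤ ‖A − Lw‖²). The tool for
ShearStressHalfDrude and for the shared L² milestone FastObservableMeanErgodic. [difficulty:
provable-now] -/
@[route_item "route-AtomisticToContinuum-AntiMazurCoboundaries"]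
def VarianceCertificate : Prop :=
  ∀ (ε : ℝ) (N : ℕ) (Φ : Literature.Analysis.FluidPDE.HardSphereFlow (Literature.Analysis.FluidPDE.Torus.geometry (Fin 3)) ε (N + 1)) (μ : MeasureTheory.Measure (Literature.Analysis.FluidPDE.Config (N + 1) (Fin 3) Literature.MathematicalPhysics.KineticTheory.T3)), MeasureTheory.IsProbabilityMeasure μ → (∀ t, MeasureTheory.MeasurePreserving (Φ.flow t) μ μ) → μ Φ.goodᶜ = 0 → ∀ (F W : Literature.Analysis.FluidPDE.Config (N + 1) (Fin 3) Literature.MathematicalPhysics.KineticTheory.T3 → ℝ), Measurable F → Measurable W → (∃ C : ℝ, ∀ z, |F z| ≤ C) → (∃ C : ℝ, ∀ z, |W z| ≤ C) → ∀ (h lag : ℝ), 0 < h → 0 < lag → ∫⁻ z, ENNReal.ofReal ((h⁻¹ * ∫ s in (0 : ℝ)..h, F (Φ.flow s z)) ^ 2) ∂μ ≤ 2 * ∫⁻ z, ENNReal.ofReal ((F z - lag⁻¹ * (W (Φ.flow lag z) - W z)) ^ 2) ∂μ + 8 * ∫⁻ z, ENNReal.ofReal ((h⁻¹ * W z) ^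 2) ∂μ

/-- item stmt-AtomisticToContinuum-14139 · support · rank 9 · closed · proved by Summit.AtomisticToContinuum.HydrodynamicLimit.Theorems.pressureCertificateTransfer_proof (prover) · by planner
sources: KipnisLandim1999, OllaVaradhanYau1993
[support] glue CorrectorPressureDecay → KineticFluxLdDecay: take τ := τ₀ and the same N₀; for N ≥ N₀
and Φ apply ExponentialCertificate to μ = G_N (invariant by HomogeneousInvariance; G_N =
liouville.withDensity, G_N(goodᶜ) = 0), F = Σ_i φ(x_i)g(…) (continuous, bounded by (N+1)κ;
Measurable via Continuous.measurable — BorelSpace on Config does not synthesise), the given W and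
lag, h = τ₀(N+1)^(-1/3): the two factors are ≤ e^(δ(N+1)/2) each. A conditional Lean proof
(certificate → invariance → transfer) compiled sorry-free in the gen-1 refuter pass (Glue5900.lean
on old item 5900). [difficulty: M] -/
@[route_item "route-AtomisticToContinuum-AntiMazurCoboundaries"]
def PressureCertificateTransfer : Prop :=
  CorrectorPressureDecay → KineticFluxLdDecay

/-- item stmt-AtomisticToContinuum-14140 · support · rank 9 · closed · proved by Summit.AtomisticToContinuum.HydrodynamicLimit.Theorems.antiMazurIdentity_proof (prover) · by planner
sources: Mazur1969, Suzuki1971, GomilkoHaaseTomilov2012, EngelNagel2000, Doyon2022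
[support] ABSTRACT ANTI-MAZUR (the card's Lean deliverable, next to Mazur1969_inequality; gen-1
5902, two sorry-free candidate proofs are attached as evidence there — land-ready): for a
contraction semigroup U on a real Hilbert space and any A, ‖P_Inv A‖² ≤ ‖A − c‖² for every c in the
span of the coboundaries U_s z − z (s ≥ 0), and the bound is attained to within any ε. Proof:
Pythagoras with Mazur.coboundary_mem_orthogonal, and Invᗮ ⊆ closure(span coboundaries) from
Mazur.dense_invariant_sup_coboundaries (Fix T = Fix T* for contractions; no strong continuity or U 0
= 1 needed). [difficulty: provable-now] -/
@[route_item "route-AtomisticToContinuum-AntiMazurCoboundaries"]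
def AntiMazurIdentity : Prop :=
  ∀ (E : Type) [NormedAddCommGroup E] [InnerProductSpace ℝ E] [CompleteSpace E] (U : ℝ → E →L[ℝ] E), Literature.Barriers.AtomisticToContinuum.Mazur.IsContractionSemigroup U → ∀ A : E, (∀ c ∈ Submodule.span ℝ {y : E | ∃ s : ℝ, 0 ≤ s ∧ ∃ z : E, y = U s z - z}, ‖(Literature.Barriers.AtomisticToContinuum.Mazur.invariantSubspace U).starProjection A‖ ^ 2 ≤ ‖A - c‖ ^ 2) ∧ ∀ ε : ℝ, 0 < ε → ∃ c ∈ Submodule.span ℝ {y : E | ∃ s : ℝ, 0 ≤ s ∧ ∃ z : E, y = U s z - z}, ‖A - c‖ ^ 2 < ‖(Literature.Barriers.AtomisticToContinuum.Mazur.invariantSubspace U).starProjection A‖ ^ 2 + ε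

/-- item stmt-AtomisticToContinuum-9621 · support · rank 9 · closed · proved by Summit.AtomisticToContinuum.HydrodynamicLimit.Theorems.homogeneousInvariance_proof @ 733069bd6ec4 (prover) · by planner
sources: Alexander1975, CercignaniIllnerPulvirenti1994, GST2013
[support] (= stmt-AtomisticToContinuum-3073 verbatim, shared with OneParticleInfluence /
HomoenergeticRung) the canonical law with constant profiles is invariant under every hard-sphere
flow, lawAt Φ p t = p (Liouville preservation + energy and momentum conservation on the good set;
rests on PROVED cone facts). Gives E_G[X_t] = E_G[X_0] = the equilibrium values subtracted in
SoundWindow. [difficulty: provable-now] -/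
@[route_item "route-AtomisticToContinuum-AntiMazurCoboundaries"]
def HomogeneousInvariance : Prop :=
  ∀ (σ c θc : ℝ) (uc : Literature.MathematicalPhysics.KineticTheory.V3), 0 < σ → 0 < c → 0 < θc → ∀ (N : ℕ) (Φ : Literature.Analysis.FluidPDE.HardSphereFlow (Literature.Analysis.FluidPDE.Torus.geometry (Fin 3)) (Literature.MathematicalPhysics.KineticTheory.hsDiameter σ N) (N + 1)) (t : ℝ), Φ.lawAt (Literature.MathematicalPhysics.KineticTheory.localGibbsLaw σ (fun _ => c) (fun _ => uc) (fun _ => θc) N Φ) t = Literature.MathematicalPhysics.KineticTheory.localGibbsLaw σ (fun _ => c) (fun _ => uc) (fun _ => θc) N Φ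

/-- item stmt-AtomisticToContinuum-9240 · assembly · rank 1 · closed · proved by Summit.AtomisticToContinuum.HydrodynamicLimit.Theorems.hydrodynamicLimit_of_relEntropyVanishing (prover) · by planner
sources: KipnisLandim1999, OllaVaradhanYau1993
[assembly] RelEntropyVanishing → HydrodynamicLimit, concluding the sub-problem Statement decl
`_root_.HydrodynamicLimit` BY NAME (D-0027 §2.1; the retired shared item 0769 concluded the
definitionally equal Literature constant): entropy inequality μ(A) ≤ (log 2 + H(μ|λ))/log(1 +
1/λ(A)) (Literature.Probability.Entropy.KipnisLandim1999_A1_8_2, proved) with λ(A) ≤ C e^(−(N+1)/C)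
and H = o(N); lawAt = map (flow t) and measurable_flow move the event to time 0. The DECIDING
THEOREM `closes : RelEntropyVanishing → (cruxes) → (supports) → Assembly → _root_.HydrodynamicLimit
:= fun h₀ … h₁ => h₁ h₀` is generated by the gate (sorry-free, axioms
propext/Classical.choice/Quot.sound; elaborated in the planner's GlueTest.lean). -/
@[route_item "route-AtomisticToContinuum-AntiMazurCoboundaries"]
def Assembly : Prop :=
  RelEntropyVanishing → _root_.HydrodynamicLimit

end Summit.AtomisticToContinuum.HydrodynamicLimit.Theses.AntiMazurCoboundaries
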